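import Mathlib

/-!
# `FeketeSOS.SublinearShadow` (stmt-ValiantsHypothesis-14990), line `Sketch`, reshape 5 — stub `stub_binaryQuarticSplit`

**A complex binary quartic form splits into two binary quadratic forms.**  For `φ : Fin 5 → ℂ` and any
`M, N ∈ ℂ[X]`, the evaluated binary quartic `Σ_{k<5} φ_k M^k N^{4-k}` is the product of two evaluated binary
quadratics `Σ_{k<3} α_k M^k N^{2-k}` and `Σ_{k<3} β_k M^k N^{2-k}`.  Proof: the univariate quartic
`Φ(t) = Σ φ_k t^k` (natDegree `≤ 4`) factors over `ℂ` as `a(t) b(t)` with `natDegree a, b ≤ 2` (pull out linear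
factors `t - θ` at roots, `IsAlgClosed.exists_root`); comparing coefficients gives
`φ_k = Σ_{i+j=k} α_i β_j` (`α_i, β_j` the coefficients of `a, b`), and these five identities homogenise to the
claimed identity in `ℂ[X]` by `ring`.
-/

namespace Summit.ValiantsHypothesis.ValiantsHypothesis.Theorems.SublinearShadowSketch

-- `Summit.ValiantsHypothesis.ValiantsHypothesis.…` is the tree's mandated single-conjunct layout (Sub = Summit).
set_option linter.dupNamespace false

open Polynomial Finset IsLocalRing Matrix
open scoped BigOperators

/-- Root pulling over `ℂ`: a polynomial of positive degree is `(X - C θ) * Q` with `natDegree Q = natDegree P - 1`. -/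
theorem bqs_pull (P : ℂ[X]) (hP : 0 < P.natDegree) :
    ∃ (θ : ℂ) (Q : ℂ[X]), P = (X - C θ) * Q ∧ Q.natDegree = P.natDegree - 1 := by
  obtain ⟨θ, hθ⟩ := IsAlgClosed.exists_root P (natDegree_pos_iff_degree_pos.mp hP).ne'
  refine ⟨θ, P /ₘ (X - C θ), (mul_divByMonic_eq_iff_isRoot.mpr hθ).symm, ?_⟩
  rw [natDegree_divByMonic P (monic_X_sub_C θ), natDegree_X_sub_C]

/-- A complex polynomial of `natDegree ≤ m + 2` is a product `a * b` with `natDegree a ≤ m` and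
`natDegree b ≤ 2` (induction on `m`, pulling out one linear factor at a time). -/
theorem bqs_factor (m : ℕ) : ∀ P : ℂ[X], P.natDegree ≤ m + 2 →
    ∃ a b : ℂ[X], a.natDegree ≤ m ∧ b.natDegree ≤ 2 ∧ P = a * b := by
  induction m with
  | zero => exact fun P hP => ⟨1, P, by simp, by simpa using hP, (one_mul P).symm⟩
  | succ m ih =>
    intro P hP
    by_cases hle : P.natDegree ≤ m + 2
    · obtain ⟨a, b, ha, hb, hab⟩ := ih P hle
      exact ⟨a, b, ha.trans (Nat.le_succ m), hb, hab⟩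
    · obtain ⟨θ, Q, hPQ, hQ⟩ := bqs_pull P (by omega)
      obtain ⟨a, b, ha, hb, hab⟩ := ih Q (by omega)
      refine ⟨(X - C θ) * a, b, ?_, hb, by rw [hPQ, hab, mul_assoc]⟩
      calc ((X - C θ) * a).natDegree ≤ (X - C θ).natDegree + a.natDegree := natDegree_mul_le
        _ ≤ 1 + m := add_le_add (natDegree_X_sub_C_le θ) ha
        _ = m + 1 := add_comm 1 m

/-- Two explicit complex quartics `Σ_{k<5} C u_k X^k` that are equal have equal coefficients. -/
theorem bqs_quartic_coeff {u₀ u₁ u₂ u₃ u₄ v₀ v₁ v₂ v₃ v₄ : ℂ}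
    (h : C u₀ + C u₁ * X + C u₂ * X ^ 2 + C u₃ * X ^ 3 + C u₄ * X ^ 4 =
      C v₀ + C v₁ * X + C v₂ * X ^ 2 + C v₃ * X ^ 3 + C v₄ * X ^ 4) :
    u₀ = v₀ ∧ u₁ = v₁ ∧ u₂ = v₂ ∧ u₃ = v₃ ∧ u₄ = v₄ := by
  refine ⟨?_, ?_, ?_, ?_, ?_⟩
  · simpa [coeff_C, coeff_C_mul_X, coeff_C_mul_X_pow] using congrArg (coeff · 0) h
  · simpa [coeff_C, coeff_C_mul_X, coeff_C_mul_X_pow] using congrArg (coeff · 1) h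
  · simpa [coeff_C, coeff_C_mul_X, coeff_C_mul_X_pow] using congrArg (coeff · 2) h
  · simpa [coeff_C, coeff_C_mul_X, coeff_C_mul_X_pow] using congrArg (coeff · 3) h
  · simpa [coeff_C, coeff_C_mul_X, coeff_C_mul_X_pow] using congrArg (coeff · 4) h

/-- The coefficient system of a quartic-into-quadratics factorisation is solvable over `ℂ`:
`φ_k = Σ_{i+j=k} α_i β_j` for `k ≤ 4`. -/
theorem bqs_coeffs (φ : Fin 5 → ℂ) : ∃ α β : Fin 3 → ℂ,
    φ 0 = α 0 * β 0 ∧ φ 1 = α 0 * β 1 + α 1 * β 0 ∧ φ 2 = α 0 * β 2 + α 1 * β 1 + α 2 * β 0 ∧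
      φ 3 = α 1 * β 2 + α 2 * β 1 ∧ φ 4 = α 2 * β 2 := by
  obtain ⟨a, b, ha, hb, hab⟩ := bqs_factor 2
    (C (φ 0) + C (φ 1) * X + C (φ 2) * X ^ 2 + C (φ 3) * X ^ 3 + C (φ 4) * X ^ 4) (by compute_degree!)
  rw [eq_quadratic_of_degree_le_two (degree_le_of_natDegree_le ha),
    eq_quadratic_of_degree_le_two (degree_le_of_natDegree_le hb)] at hab
  refine ⟨![a.coeff 0, a.coeff 1, a.coeff 2], ![b.coeff 0, b.coeff 1, b.coeff 2], ?_⟩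
  simp only [Matrix.cons_val_zero, Matrix.cons_val_one, Matrix.cons_val_two, Matrix.head_cons,
    Matrix.tail_cons]
  apply bqs_quartic_coeff
  rw [hab]
  simp only [map_add, map_mul]
  ring

/-- **Stub (SF2): a complex binary quartic form splits into two binary quadratic forms**, evaluated at any
`M, N ∈ ℂ[X]`: `Σ_{k<5} φ_k M^k N^{4-k} = (Σ_{k<3} α_k M^k N^{2-k}) (Σ_{k<3} β_k M^k N^{2-k})`.
[folklore: `ℂ` is algebraically closed, so binary forms factor into linear forms] -/
theorem stub_binaryQuarticSplit (φ : Fin 5 → ℂ) (M N : ℂ[X]) :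
    ∃ (α β : Fin 3 → ℂ), (∑ k : Fin 5, C (φ k) * (M ^ (k : ℕ) * N ^ (4 - (k : ℕ))))
      = (∑ k : Fin 3, C (α k) * (M ^ (k : ℕ) * N ^ (2 - (k : ℕ))))
        * (∑ k : Fin 3, C (β k) * (M ^ (k : ℕ) * N ^ (2 - (k : ℕ)))) := by
  obtain ⟨α, β, h0, h1, h2, h3, h4⟩ := bqs_coeffs φ
  refine ⟨α, β, ?_⟩
  simp only [Fin.sum_univ_five, Fin.sum_univ_three, Fin.isValue, Fin.coe_ofNat_eq_mod, Nat.reduceMod,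
    Nat.reduceSub, h0, h1, h2, h3, h4, map_add, map_mul]
  ring

end Summit.ValiantsHypothesis.ValiantsHypothesis.Theorems.SublinearShadowSketch
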